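import Mathlib
import Summits.KontsevichZagierPeriods.Zeta5Search.BrickHatReduction
import Summits.KontsevichZagierPeriods.Zeta5Search.BrickTheoremEight

/-!
# BrickTheoremNine — zi-p2's THEOREM 9 (iv) OFF-DIGIT DEPTH THEOREM and (v) the supercongruence (S)
`β_s(np) ≡ β_s(n) (mod p³)` for the FULL coefficient vector of the Ball/Rivoal brick linear forms at EVERY level
`L(n) ≤ A`, i.e. for every `1 ≤ n < p^{A+1}` (cell zeta5-irr)

HONEST FRAMING: systematic search; no irrationality claim unless certified. INSTRUMENT theorem of the ζ(5)
census cell zeta5-irr (HOME `run/shared/lean/pub/zeta5-irr/`; memo `zi-p2/probes/B8/thm9/THEOREM9.md` (sealed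
eae326393abac726, certificate kit j274928 «light9» 127 rows ALL predictions met, zi-ref T9-ANALYTIC «§3 IS A PROOF —
NO GAP FOUND») §2 «(iv) OFF-DIGIT DEPTH THEOREM. If L(n−1) ≤ A (i.e. n ≤ p^{A+1}), or if n is a power of p, then for
every s ∈ {0} ∪ [1,A]: v(OFF^{(s)}) ≥ A, i.e. v(Σ_{K≤np, p∤K} r_K^{(s)}(np)) ≥ A + L(n) + 1» and «(v) COROLLARY — (S) AT THE
BOTTOM A+1 LEVELS. β_s(np) ≡ β_s(n) (mod p³) for every s ∈ {0,1,…,A} and EVERY 1 ≤ n < p^{A+1} … (4,1) [Apéry's ζ(3)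
numbers, Ball's form]: n < p⁵ (before THEOREM 9: n < p only); (6,1) [Rivoal/Ball ζ(5) forms], (6,2): n < p⁷ (before:
p³)»). Here in the β-free NOMINAL-LEVEL form of `BrickTheoremEight` (`n < p^{L+1}`, `x_s(n) = Σ_K c_{K,s}(n)` =
`BrickPartialFractions.xCoeff`, `β_s(n) = p^{L(n)τ_s}x_s(n)`, `τ_s = A − 1 − s`): THEOREM 8⁺'s hypothesis `L + 4 ≤ A` is
replaced by `L ≤ A`. WHAT THIS IS NOT: not an irrationality statement; nothing about ζ(5); no denominator saving; 0
nats/n; rung F-Z1 NOT moved. It is the p-adic STRUCTURE (bottom `A + 1` p-layers) of the coefficient vectors. Filed by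
the engine seat zi-eng (g10); inputs `BrickHatReduction.hat_block_main{,_zero}` (LEMMA 9.4), `BrickHatWeight.propositionH_hatG`
(PROPOSITION H° on the row `n − 1` with the hat weight `g₀`), `BrickTheoremEight.sum_digitD{,Zero}_le_level` (digit side).

## The statements (`p ≥ 5` prime — `p` odd suffices for (iv) —, `A` even, `1 ≤ B`, `2B ≤ A`)

* `sum_offDigit_eq`: `Σ_{K ≤ np, p∤K} F(K) = Σ_{j<n} Σ_{i=1}^{p−1} F(jp+i)`.
* **`offDigit_sum_le`**, **`offDigitZero_sum_le`** (THEOREM 9 (iv)): for `L ≤ A`, `n = m + 1`, `m < p^{L+1}`, every `s`: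
  `v(Σ_{K≤np, p∤K} p^{(L+1)(A−s)}c_{K,s}(np)) ≤ exp(−(A+L+1))`, and the same for the harmonic cell.
* **`theoremNine_S`**, **`theoremNine_Z`**, **`theoremNine`** (THEOREM 9 (v)): for `3 ≤ A`, `L ≤ A`, `n < p^{L+1}`,
  `s + 1 ≤ A`: `v(p^{(L+1)τ_s}x_s(np) − p^{Lτ_s}x_s(n)) ≤ exp(−3)`, and the same for `x_0` (`τ_0 = A − 1`) — supersedes
  `BrickTheoremEight.theoremEight{_S,_Z,}` (`L + 4 ≤ A`).
-/

namespace Summit.KontsevichZagierPeriods.Zeta5Search.BrickTheoremNine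

open Finset Nat WithZero
open Summit.KontsevichZagierPeriods.Zeta5Search.BrickLaurent (laurent cell)
open Summit.KontsevichZagierPeriods.Zeta5Search.BrickPartialFractions (cellZero xCoeff xZero)
open Summit.KontsevichZagierPeriods.Zeta5Search.BrickDigitStepD (digitD)
open Summit.KontsevichZagierPeriods.Zeta5Search.BrickDigitStepDZero (digitDZero)
open Summit.KontsevichZagierPeriods.Zeta5Search.BrickTheoremSixS (sum_filter_dvd_eq)
open Summit.KontsevichZagierPeriods.Zeta5Search.BrickHatWeight (hatG propositionH_hatG)
open Summit.KontsevichZagierPeriods.Zeta5Search.BrickHatReduction (hat_block_main hat_block_main_zero)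
open Summit.KontsevichZagierPeriods.Zeta5Search.BrickTheoremEight (sum_digitD_le_level sum_digitDZero_le_level)

noncomputable section

variable {p : ℕ} [Fact p.Prime]

/-! ## The off-digit cells, block by block -/

/-- Reindexing the off-digit cells of the row `np` by block and digit:
`Σ_{K ≤ np, p ∤ K} F(K) = Σ_{j < n} Σ_{t < p−1} F((t+1) + jp)`. -/
theorem sum_offDigit_eq (F : ℕ → ℚ) (n : ℕ) :
    ∑ K ∈ (range (n * p + 1)).filter (fun K => ¬ p ∣ K), F K =
      ∑ j ∈ range n, ∑ t ∈ range (p - 1), F (t + 1 + j * p) := by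
  have hp : p.Prime := Fact.out
  have hp0 : 0 < p := hp.pos
  symm
  calc ∑ j ∈ range n, ∑ t ∈ range (p - 1), F (t + 1 + j * p)
      = ∑ x ∈ range n ×ˢ range (p - 1), F (x.2 + 1 + x.1 * p) :=
        (Finset.sum_product (range n) (range (p - 1)) (fun x : ℕ × ℕ => F (x.2 + 1 + x.1 * p))).symm
    _ = _ := by
      refine Finset.sum_nbij' (fun x => x.2 + 1 + x.1 * p) (fun K => (K / p, K % p - 1)) ?_ ?_ ?_ ?_ (fun _ _ => rfl)
      · intro x hx
        rw [mem_product, mem_range, mem_range] at hx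
        rw [mem_filter, mem_range]
        refine ⟨?_, fun hdvd => ?_⟩
        · have h1 : x.1 * p + p ≤ n * p := by
            have := Nat.mul_le_mul_right p (show x.1 + 1 ≤ n by omega); rwa [add_mul, one_mul] at this
          omega
        · have hmod : (x.2 + 1 + x.1 * p) % p = x.2 + 1 := by
            rw [Nat.add_mul_mod_self_right, Nat.mod_eq_of_lt (by omega)]
          have := (Nat.dvd_iff_mod_eq_zero).1 hdvd
          omega
      · intro K hK
        rw [mem_filter, mem_range] at hK
        rw [mem_product, mem_range, mem_range]
        have hKnp : K ≠ n * p := fun h => hK.2 (h ▸ dvd_mul_left p n)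
        have hmod0 : K % p ≠ 0 := fun h => hK.2 (Nat.dvd_of_mod_eq_zero h)
        have hmodp : K % p < p := Nat.mod_lt _ hp0
        refine ⟨(Nat.div_lt_iff_lt_mul hp0).2 (by omega), by omega⟩
      · intro x hx
        rw [mem_product, mem_range, mem_range] at hx
        refine Prod.ext ?_ ?_
        · show (x.2 + 1 + x.1 * p) / p = x.1
          rw [Nat.add_mul_div_right _ _ hp0, Nat.div_eq_of_lt (by omega), zero_add]
        · show (x.2 + 1 + x.1 * p) % p - 1 = x.2
          rw [Nat.add_mul_mod_self_right, Nat.mod_eq_of_lt (by omega), Nat.add_sub_cancel]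
      · intro K hK
        rw [mem_filter, mem_range] at hK
        have hmod0 : K % p ≠ 0 := fun h => hK.2 (Nat.dvd_of_mod_eq_zero h)
        show K % p - 1 + 1 + K / p * p = K
        rw [Nat.sub_add_cancel (by omega)]
        exact Nat.mod_add_div' K p

section offDigit

variable (hp2 : p ≠ 2) {A B : ℕ} (hA : Even A) (hB : 1 ≤ B) (hAB : 2 * B ≤ A) {L m : ℕ} (hLA : L ≤ A)
  (hm : m < p ^ (L + 1))
include hp2 hA hB hAB hLA hm

/-- **THEOREM 9 (iv), OFF-DIGIT DEPTH, cells `s ≥ 1`** (and every `s`): for `p` odd, `A` even, `1 ≤ B`, `2B ≤ A`, `L ≤ A`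
and the row `np`, `n = m + 1`, `m < p^{L+1}`:
`v(Σ_{K≤np, p∤K} p^{(L+1)(A−s)}·c_{K,s}(np)) ≤ exp(−(A+L+1))` — zi-p2's `v(OFF^{(s)}) ≥ A` (LEMMA 9.4 blockwise, then
PROPOSITION H° for the hat weight `g₀` on the row `m`). -/
theorem offDigit_sum_le (s : ℕ) :
    Rat.padicValuation p (∑ K ∈ (range ((m + 1) * p + 1)).filter (fun K => ¬ p ∣ K),
      (p : ℚ) ^ ((L + 1) * (A - s)) * cell A B 1 ((m + 1) * p) K s) ≤ exp (-((A : ℤ) + L + 1)) := by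
  have hp : p.Prime := Fact.out
  rw [sum_offDigit_eq]
  have hmain := (propositionH_hatG hp2 hA hAB hB hLA hm).1 s
  rw [show ∑ j ∈ range (m + 1), ∑ t ∈ range (p - 1), (p : ℚ) ^ ((L + 1) * (A - s)) * cell A B 1 ((m + 1) * p) (t + 1 + j * p) s
      = ∑ j ∈ range (m + 1), (∑ t ∈ range (p - 1), (p : ℚ) ^ ((L + 1) * (A - s)) *
          laurent A B 1 ((m + 1) * p) (t + 1 + j * p) (A - s) -
          (p : ℚ) ^ (A + 1) * hatG A B p m j * ((p : ℚ) ^ (L * (A - s)) * laurent A B 0 m j (A - s))) +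
        (p : ℚ) ^ (A + 1) * ∑ j ∈ range (m + 1), hatG A B p m j * ((p : ℚ) ^ (L * (A - s)) * cell A B 0 m j s) by
      rw [Finset.mul_sum, ← Finset.sum_add_distrib]
      refine Finset.sum_congr rfl fun j _ => ?_
      simp only [cell]
      ring]
  refine (Valuation.map_add _ _ _).trans (max_le (Valuation.map_sum_le _ fun j hj => ?_) ?_)
  · exact hat_block_main hp2 hA hAB hm (by have := mem_range.1 hj; omega) (A - s)
  · rw [map_mul, map_pow, Rat.padicValuation_self, ← exp_nsmul]
    calc _ ≤ exp ((A + 1) • (-1 : ℤ)) * exp (-(L : ℤ)) := mul_le_mul' le_rfl hmain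
      _ = _ := by rw [← exp_add]; congr 1; simp only [nsmul_eq_mul]; push_cast; ring

/-- **THEOREM 9 (iv), OFF-DIGIT DEPTH, harmonic cell**: `v(Σ_{K≤np, p∤K} p^{(L+1)A}·cell^{(0)}_K(np)) ≤ exp(−(A+L+1))`. -/
theorem offDigitZero_sum_le :
    Rat.padicValuation p (∑ K ∈ (range ((m + 1) * p + 1)).filter (fun K => ¬ p ∣ K),
      (p : ℚ) ^ ((L + 1) * A) * cellZero A B 1 ((m + 1) * p) K) ≤ exp (-((A : ℤ) + L + 1)) := by
  have hp : p.Prime := Fact.out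
  rw [sum_offDigit_eq]
  have hmain := (propositionH_hatG hp2 hA hAB hB hLA hm).2
  rw [show ∑ j ∈ range (m + 1), ∑ t ∈ range (p - 1), (p : ℚ) ^ ((L + 1) * A) * cellZero A B 1 ((m + 1) * p) (t + 1 + j * p)
      = ∑ j ∈ range (m + 1), (∑ t ∈ range (p - 1), (p : ℚ) ^ ((L + 1) * A) * cellZero A B 1 ((m + 1) * p) (t + 1 + j * p) -
          (p : ℚ) ^ (A + 1) * hatG A B p m j * ((p : ℚ) ^ (L * A) * cellZero A B 0 m j)) +
        (p : ℚ) ^ (A + 1) * ∑ j ∈ range (m + 1), hatG A B p m j * ((p : ℚ) ^ (L * A) * cellZero A B 0 m j) by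
      rw [Finset.mul_sum, ← Finset.sum_add_distrib]
      refine Finset.sum_congr rfl fun j _ => ?_
      ring]
  refine (Valuation.map_add _ _ _).trans (max_le (Valuation.map_sum_le _ fun j hj => ?_) ?_)
  · exact hat_block_main_zero hp2 hA hAB hm (by have := mem_range.1 hj; omega)
  · rw [map_mul, map_pow, Rat.padicValuation_self, ← exp_nsmul]
    calc _ ≤ exp ((A + 1) • (-1 : ℤ)) * exp (-(L : ℤ)) := mul_le_mul' le_rfl hmain
      _ = _ := by rw [← exp_add]; congr 1; simp only [nsmul_eq_mul]; push_cast; ring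

end offDigit

/-! ## THEOREM 9 (v): (S) mod p³ at every level `L ≤ A` -/

section congruence

variable (h3 : 3 < p) {A B : ℕ} (hA : Even A) (hB : 1 ≤ B) (hAB : 2 * B ≤ A) (hA3 : 3 ≤ A)
include h3 hA hB hAB hA3

/-- The off-digit half of `β_s(np) − β_s(n)` is `≡ 0 (mod p³)` at every level `L ≤ A` (`n < p^{L+1}`, `s + 1 ≤ A`,
`A ≥ 3`): `v(Σ_{K≤np, p∤K} p^{(L+1)τ_s}c_{K,s}(np)) ≤ exp(−A) ≤ exp(−3)`. -/
theorem offDigit_sum_le_three {L n s : ℕ} (hLA : L ≤ A) (hn : n < p ^ (L + 1)) (hs : s + 1 ≤ A) :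
    Rat.padicValuation p (∑ K ∈ (range (n * p + 1)).filter (fun K => ¬ p ∣ K),
      (p : ℚ) ^ ((L + 1) * (A - 1 - s)) * cell A B 1 (n * p) K s) ≤ exp (-3) := by
  have hp : p.Prime := Fact.out
  have hp2 : p ≠ 2 := by omega
  have hpQ : (p : ℚ) ≠ 0 := by exact_mod_cast hp.ne_zero
  rcases n with _ | m
  · rw [Finset.sum_eq_zero fun K hK => ?_, map_zero]
    · exact _root_.zero_le
    · exfalso
      rw [mem_filter, mem_range] at hK
      exact hK.2 (by rw [show K = 0 by omega]; exact dvd_zero p)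
  · have hm : m < p ^ (L + 1) := by omega
    have hfac : ∀ K, (p : ℚ) ^ ((L + 1) * (A - 1 - s)) * cell A B 1 ((m + 1) * p) K s =
        ((p : ℚ) ^ (L + 1))⁻¹ * ((p : ℚ) ^ ((L + 1) * (A - s)) * cell A B 1 ((m + 1) * p) K s) := fun K => by
      rw [show (L + 1) * (A - s) = (L + 1) * (A - 1 - s) + (L + 1) by
        rw [← Nat.mul_succ]; congr 1; omega, pow_add]
      field_simp
      ring
    rw [Finset.sum_congr rfl fun K _ => hfac K, ← Finset.mul_sum, map_mul, map_inv₀, map_pow, Rat.padicValuation_self,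
      ← exp_nsmul, ← exp_neg]
    calc _ ≤ exp (-((L + 1) • (-1 : ℤ))) * exp (-((A : ℤ) + L + 1)) :=
          mul_le_mul' le_rfl (offDigit_sum_le hp2 hA hB hAB hLA hm s)
      _ ≤ exp (-3) := by rw [← exp_add, exp_le_exp]; simp only [nsmul_eq_mul]; push_cast; omega

/-- The off-digit half of `β_0(np) − β_0(n)` is `≡ 0 (mod p³)` at every level `L ≤ A` (harmonic cell). -/
theorem offDigitZero_sum_le_three {L n : ℕ} (hLA : L ≤ A) (hn : n < p ^ (L + 1)) :
    Rat.padicValuation p (∑ K ∈ (range (n * p + 1)).filter (fun K => ¬ p ∣ K),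
      (p : ℚ) ^ ((L + 1) * (A - 1)) * cellZero A B 1 (n * p) K) ≤ exp (-3) := by
  have hp : p.Prime := Fact.out
  have hp2 : p ≠ 2 := by omega
  have hpQ : (p : ℚ) ≠ 0 := by exact_mod_cast hp.ne_zero
  rcases n with _ | m
  · rw [Finset.sum_eq_zero fun K hK => ?_, map_zero]
    · exact _root_.zero_le
    · exfalso
      rw [mem_filter, mem_range] at hK
      exact hK.2 (by rw [show K = 0 by omega]; exact dvd_zero p)
  · have hm : m < p ^ (L + 1) := by omega
    have hfac : ∀ K, (p : ℚ) ^ ((L + 1) * (A - 1)) * cellZero A B 1 ((m + 1) * p) K =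
        ((p : ℚ) ^ (L + 1))⁻¹ * ((p : ℚ) ^ ((L + 1) * A) * cellZero A B 1 ((m + 1) * p) K) := fun K => by
      rw [show (L + 1) * A = (L + 1) * (A - 1) + (L + 1) by rw [← Nat.mul_succ]; congr 1; omega, pow_add]
      field_simp
      ring
    rw [Finset.sum_congr rfl fun K _ => hfac K, ← Finset.mul_sum, map_mul, map_inv₀, map_pow, Rat.padicValuation_self,
      ← exp_nsmul, ← exp_neg]
    calc _ ≤ exp (-((L + 1) • (-1 : ℤ))) * exp (-((A : ℤ) + L + 1)) :=
          mul_le_mul' le_rfl (offDigitZero_sum_le hp2 hA hB hAB hLA hm)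
      _ ≤ exp (-3) := by rw [← exp_add, exp_le_exp]; simp only [nsmul_eq_mul]; push_cast; omega

/-- **THEOREM 9 (v), cells `s ≥ 1`** (zi-p2; `p ≥ 5`, `A ≥ 3` even, `1 ≤ B`, `2B ≤ A`): for EVERY level `L ≤ A`, every
`n < p^{L+1}` and `s + 1 ≤ A`: `v_p(p^{(L+1)τ_s}·x_s(np) − p^{Lτ_s}·x_s(n)) ≥ 3`, `τ_s = A − 1 − s` — the normalised Dwork
congruence `β_s(np) ≡ β_s(n) (mod p³)` on the bottom `A + 1` `p`-adic levels (THEOREM 8⁺: `L + 4 ≤ A`). -/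
theorem theoremNine_S {L n s : ℕ} (hLA : L ≤ A) (hn : n < p ^ (L + 1)) (hs : s + 1 ≤ A) :
    Rat.padicValuation p ((p : ℚ) ^ ((L + 1) * (A - 1 - s)) * xCoeff A B 1 (n * p) s -
      (p : ℚ) ^ (L * (A - 1 - s)) * xCoeff A B 1 n s) ≤ exp (-3) := by
  set τ := A - 1 - s with hτ
  have hsplit : (p : ℚ) ^ ((L + 1) * τ) * xCoeff A B 1 (n * p) s - (p : ℚ) ^ (L * τ) * xCoeff A B 1 n s =
      ∑ j ∈ range (n + 1), digitD A B p L n j s +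
        ∑ K ∈ (range (n * p + 1)).filter (fun K => ¬ p ∣ K), (p : ℚ) ^ ((L + 1) * τ) * cell A B 1 (n * p) K s := by
    unfold xCoeff
    rw [Finset.mul_sum, Finset.mul_sum, ← sum_filter_add_sum_filter_not (range (n * p + 1)) (fun K => p ∣ K),
      sum_filter_dvd_eq, add_sub_right_comm, ← Finset.sum_sub_distrib]
    congr 1
    refine Finset.sum_congr rfl fun j _ => ?_
    rw [digitD, hτ, add_mul, one_mul, pow_add]
    ring
  rw [hsplit]
  exact (Valuation.map_add _ _ _).trans
    (max_le (sum_digitD_le_level h3 hA hB hAB hLA hn hs) (offDigit_sum_le_three h3 hA hB hAB hA3 hLA hn hs))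

/-- **THEOREM 9 (v), harmonic cell `s = 0`**: `v_p(p^{(L+1)(A−1)}·x_0(np) − p^{L(A−1)}·x_0(n)) ≥ 3` for every
`L ≤ A`, `n < p^{L+1}`. -/
theorem theoremNine_Z {L n : ℕ} (hLA : L ≤ A) (hn : n < p ^ (L + 1)) :
    Rat.padicValuation p ((p : ℚ) ^ ((L + 1) * (A - 1)) * xZero A B 1 (n * p) -
      (p : ℚ) ^ (L * (A - 1)) * xZero A B 1 n) ≤ exp (-3) := by
  set τ := A - 1 with hτ
  have hsplit : (p : ℚ) ^ ((L + 1) * τ) * xZero A B 1 (n * p) - (p : ℚ) ^ (L * τ) * xZero A B 1 n =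
      ∑ j ∈ range (n + 1), digitDZero A B p L n j +
        ∑ K ∈ (range (n * p + 1)).filter (fun K => ¬ p ∣ K), (p : ℚ) ^ ((L + 1) * τ) * cellZero A B 1 (n * p) K := by
    unfold xZero
    rw [Finset.mul_sum, Finset.mul_sum, ← sum_filter_add_sum_filter_not (range (n * p + 1)) (fun K => p ∣ K),
      sum_filter_dvd_eq, add_sub_right_comm, ← Finset.sum_sub_distrib]
    congr 1
    refine Finset.sum_congr rfl fun j _ => ?_
    rw [digitDZero, hτ, add_mul, one_mul, pow_add]
    ring
  rw [hsplit]
  exact (Valuation.map_add _ _ _).trans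
    (max_le (sum_digitDZero_le_level h3 hA hB hAB hLA (by omega) hn) (offDigitZero_sum_le_three h3 hA hB hAB hA3 hLA hn))

/-- **THEOREM 9 (v) = the whole display (S) at every level `L ≤ A`** (zi-p2 THEOREM 9 COROLLARY): for `p ≥ 5`, `A ≥ 3`
even, `1 ≤ B`, `2B ≤ A`, `L ≤ A` and every `n < p^{L+1}`: the harmonic cell and every cell `s + 1 ≤ A` satisfy
`β_s(np) ≡ β_s(n) (mod p³)` in normalised form. With `L` ranging over `0, …, A` this covers EVERY `1 ≤ n < p^{A+1}`:
for `(A,B) = (4,1)` (Ball's form of Apéry's ζ(3) numbers) `n < p⁵`, for `(6,1), (6,2)` (Rivoal/Ball ζ(5)-type forms)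
`n < p⁷` — supersedes `BrickTheoremEight.theoremEight` (`n < p^{A−3}`). -/
theorem theoremNine {L n : ℕ} (hLA : L ≤ A) (hn : n < p ^ (L + 1)) :
    Rat.padicValuation p ((p : ℚ) ^ ((L + 1) * (A - 1)) * xZero A B 1 (n * p) -
        (p : ℚ) ^ (L * (A - 1)) * xZero A B 1 n) ≤ exp (-3) ∧
      ∀ s, s + 1 ≤ A → Rat.padicValuation p ((p : ℚ) ^ ((L + 1) * (A - 1 - s)) * xCoeff A B 1 (n * p) s -
        (p : ℚ) ^ (L * (A - 1 - s)) * xCoeff A B 1 n s) ≤ exp (-3) :=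
  ⟨theoremNine_Z h3 hA hB hAB hA3 hLA hn, fun _ hs => theoremNine_S h3 hA hB hAB hA3 hLA hn hs⟩

end congruence

end

end Summit.KontsevichZagierPeriods.Zeta5Search.BrickTheoremNine
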